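import Summits.ABC.IUTFork.Joshi.RosettaFragment2Coverings
import HarnessLib

/-!
# [J-III] Lemma 8.4.1 (2) DERIVED from «the coverings are characteristic» ([IUTchI] Cor. 1.2) — the printed proof, typed

Sequel of `Summits/ABC/IUTFork/Joshi/RosettaFragment2Coverings.lean` (abc-iut-E-t16, slot T-16, p429281). K. Joshi,
arXiv:2401.13508v4 §8.4, Lemma 8.4.1 (p.80 l.36–p.81 l.7; bib `Joshi2024ATS3`, UNREFEREED, claim status `disputed`;
typed ≠ proved ≠ endorsed; no side taken on [IUTchIII] Cor. 3.12 or on any author). The statement file typed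
Lemma 8.4.1 (2) — «the isomorphism class of the diagram of topological groups, obtained by applying the étale (resp.
tempered fundamental group) functor to this diagram of coverings obtained using `hol(X/L)_y`, is independent of the
choice of the arithmeticoid `arith(L)_y`» — as the claim-Prop `Rosetta.Lemma841`, and recorded the printed PROOF
(p.81 l.4–7): «the isomorphism class of the diagram of groups is determined from the étale fundamental group (resp. the
tempered fundamental group) of `X/L` (resp. `X/L_v`) and its stack quotients by `{±1}`» — i.e. Mochizuki's
[IUTchI] Cor. 1.2 «Characteristic Nature of Coverings» (tree: `Literature.IUT.HodgeTheaters.PuncturedEllipticData.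
CharacteristicNatureOfCoverings`, the covers `X̲_K, C̲_K, X→_K, C→_K` are cut out group-theoretically inside `Π`).
HERE that proof is TYPED and RUN: a `CoveringRecipe ι` assigns to every topological group an `ι`-indexed diagram of open
subgroups NATURALLY under isomorphisms of topological groups (this is what «characteristic» / «determined from the
fundamental group» means); PROVED: for any family of holomorphoid groups that are pairwise isomorphic as topological
groups (Fragment 1, Thm. 2.4.1 (3) «abstractly isomorphic»; [J-I] Thm. (thm:main) (4)) the diagrams produced by a recipe
satisfy `Lemma841` (`lemma841_of_recipe`). So Lemma 8.4.1 (2) REDUCES, in kernel, to two named inputs: a characteristic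
recipe (Cor. 1.2's content) and the isomorphy of the groups (`Rosetta.GroupLikeIsomorphic`-type input) — neither is
asserted here. Standard axioms only; sorry-free. bears_on: LADDER-ABC:A2.E.
-/

namespace Summit.ABC.IUTFork.Joshi.Rosetta

/-- **A characteristic covering recipe** ([IUTchI] Cor. 1.2 «characteristic nature of coverings», read abstractly; Joshi's
proof of Lemma 8.4.1 p.81 l.4–7 «determined from the … fundamental group»): a rule producing, for EVERY topological
group `Γ`, an `ι`-indexed diagram of open subgroups, compatible with all isomorphisms of topological groups. HYPOTHESIS
structure (the tree's `PuncturedEllipticData` recipes `piXarrow`/`piCarrow` are the intended instances once their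
naturality under `≃ₜ*` is recorded); nothing asserted. [claim: Joshi2024ATS3, status: disputed] -/
structure CoveringRecipe (ι : Type) : Type 1 where
  /-- the diagram the recipe cuts out inside `Γ` -/
  diag : ∀ (Γ : Type) [Group Γ] [TopologicalSpace Γ], CoveringDiagram ι Γ
  /-- naturality under isomorphisms of topological groups («characteristic») -/
  natural : ∀ {Γ₁ Γ₂ : Type} [Group Γ₁] [TopologicalSpace Γ₁] [Group Γ₂] [TopologicalSpace Γ₂]
    (e : Γ₁ ≃ₜ* Γ₂) (i : ι), ((diag Γ₁).sub i).map e.toMonoidHom = (diag Γ₂).sub i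

variable {ι : Type}

/-- PROVED: a characteristic recipe yields isomorphic diagrams on isomorphic groups. -/
theorem CoveringRecipe.diagramIso_of_iso (R : CoveringRecipe ι) {Γ₁ Γ₂ : Type} [Group Γ₁] [TopologicalSpace Γ₁]
    [Group Γ₂] [TopologicalSpace Γ₂] (e : Γ₁ ≃ₜ* Γ₂) : DiagramIso (R.diag Γ₁) (R.diag Γ₂) :=
  ⟨e, fun i => R.natural e i⟩

/-- PROVED — **Lemma 8.4.1 (2) from its printed proof**: if the diagram of coverings attached to each holomorphoid datum
`y` is produced by ONE characteristic recipe applied to its group `Γof y = Π^temp_{X/L_v;K_{y_v}}` («determined from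
the fundamental group», p.81 l.4–7; [IUTchI] Cor. 1.2), and the groups are pairwise isomorphic as topological groups
(Thm. 2.4.1 (3) «abstractly isomorphic»), then the isomorphism class of the diagram is independent of `y`. -/
theorem lemma841_of_recipe (R : CoveringRecipe ι) {J : Type} (Γof : J → Type) [∀ y, Group (Γof y)]
    [∀ y, TopologicalSpace (Γof y)] (hiso : ∀ y₁ y₂ : J, Nonempty (Γof y₁ ≃ₜ* Γof y₂)) :
    Lemma841 Γof (fun y => R.diag (Γof y)) :=
  fun y₁ y₂ => (hiso y₁ y₂).elim fun e => R.diagramIso_of_iso e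

/-- PROVED: conversely, pairwise isomorphy of the groups is NECESSARY for Lemma 8.4.1 (2) as typed (a `DiagramIso`
carries an isomorphism of the ambient topological groups) — so, for recipe-built diagrams, Lemma 8.4.1 (2) is EQUIVALENT
to the Fragment-1 clause «corresponding group-like objects are all isomorphic». -/
theorem lemma841_iff_of_recipe (R : CoveringRecipe ι) {J : Type} (Γof : J → Type) [∀ y, Group (Γof y)]
    [∀ y, TopologicalSpace (Γof y)] :
    Lemma841 Γof (fun y => R.diag (Γof y)) ↔ ∀ y₁ y₂ : J, Nonempty (Γof y₁ ≃ₜ* Γof y₂) :=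
  ⟨fun h y₁ y₂ => (h y₁ y₂).elim fun e _ => ⟨e⟩, lemma841_of_recipe R Γof⟩

/-- The TRIVIAL recipe (every index ↦ the whole group, which is open): a kernel witness that `CoveringRecipe ι` is
inhabited for every `ι`, so the reduction above is not vacuous. [folklore] -/
def CoveringRecipe.top (ι : Type) : CoveringRecipe ι where
  diag Γ _ _ := ⟨fun _ => ⊤, fun _ => isOpen_univ⟩
  natural e i := by
    ext x
    simp only [Subgroup.mem_map, Subgroup.mem_top, true_and, iff_true]
    exact ⟨e.symm x, e.apply_symm_apply x⟩

/-- PROVED: the type of characteristic recipes is inhabited. -/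
theorem CoveringRecipe.nonempty (ι : Type) : Nonempty (CoveringRecipe ι) := ⟨CoveringRecipe.top ι⟩

end Summit.ABC.IUTFork.Joshi.Rosetta
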